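import Literature.AnabelianGeometry.EtaleTheta.FrdIVocabulary
import Literature.AnabelianGeometry.EtaleTheta.SubmonoidPerfection

/-!
# [EtTh] §3: Lemma 3.5 read with the tree's [FrdI] vocabulary — reduction to the realification clause

Mochizuki, *The étale theta function …*, Publ. RIMS **45** (2009), §3, Lemma 3.5, PRIMS PDF p. 75
(printed 301) [cite: MochizukiEtTh2009, Lem 3.5 p.75]. The statement file `DivisorMonoids.lean` (seat
abc-iut-L2-t3) records Lemma 3.5 (i), (ii) as the named facts `Lemma35_i V`, `Lemma35_ii V` over a
[FrdI]-vocabulary parameter `V : FrdIMonoidStub`; `FrdIVocabulary.lean` (same seat) fixes the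
canonical instantiation `treeMonoidVocab` (perf-factorial = `Frobenioids.IsPerfFactorial`, "`ℝ`
supports" = `Frobenioids.Supports _ .R`, realification = `IsRealificationVia`). With that reading the
"`P^pf`" portions — which print says "follow immediately from the definitions" — are the theorems of
`SubmonoidPerfection.lean` (seat abc-iut-L6-t12): `Supports Q .R` gives `IsPerfect Q`, whence existence
and uniqueness of `P^pf → Q`, its injectivity, and group-saturation of its image. This proof-only
companion records the resulting REDUCTIONS: `Lemma35_i treeMonoidVocab` (resp. `Lemma35_ii
treeMonoidVocab`) follows from its realification ("`P^rlf`") clause ALONE, stated verbatim as a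
hypothesis (`Lemma35_i_of_rlf`, `Lemma35_ii_of_rlf`); and the `P^pf` clauses hold outright
(`Lemma35_i_pf`, `Lemma35_ii_pf`). What remains to discharge Lemma 3.5 for the tree's vocabulary is
exactly the printed `P^rlf` argument (pp. 75–76, via primary components and [FrdI] Def. 2.4 (i)(d)).
No definitions. Seat abc-iut-L6-t12 (unit W2-L2-09).
-/

namespace Literature.AnabelianGeometry.EtaleTheta

open Literature.AlgebraicGeometry.Frobenioids

universe w

/-- "`ℝ` supports `Q`" ([FrdI] Def. 2.4 (ii)(c)) includes "`Q` is perfect" — the only part of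
hypothesis (c) of Lemma 3.5 that its `P^pf` portion uses. [cite: MochizukiEtTh2009, Lem 3.5 p.75] -/
theorem isPerfect_of_supports_R {Q : Type w} [CommMonoid Q] (h : Supports Q .R) : IsPerfect Q :=
  h.1

/-- **Lemma 3.5 (i), `P^pf` clauses, for the tree's vocabulary** (p. 75): under the hypotheses of
Lemma 3.5 read via `treeMonoidVocab` (indeed under "`ℝ` supports `Q`" alone), the inclusion `P ↪ Q`
extends uniquely to `P^pf → Q`, and every such extension is injective.
[cite: MochizukiEtTh2009, Lem 3.5 p.75] -/
theorem Lemma35_i_pf (Q : Type w) [CommMonoid Q] (P : Submonoid Q) (hQ : Supports Q .R) :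
    (∃! ιpf : Perfection P →* Q, ιpf.comp (Perfection.of P) = P.subtype) ∧
      ∀ ιpf : Perfection P →* Q, ιpf.comp (Perfection.of P) = P.subtype → Function.Injective ιpf :=
  ⟨Lemma35.existsUnique_extension P (isPerfect_of_supports_R hQ),
    fun ι hι => Lemma35.extension_injective ι hι⟩

/-- **Lemma 3.5 (ii), `P^pf` clause, for the tree's vocabulary** (p. 75): if `P` is group-saturated
in `Q` and "`ℝ` supports `Q`", the image of any extension `P^pf → Q` of the inclusion is
group-saturated in `Q`. [cite: MochizukiEtTh2009, Lem 3.5 p.75] -/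
theorem Lemma35_ii_pf (Q : Type w) [CommMonoid Q] (P : Submonoid Q) (hP : IsGroupSaturated P)
    (hQ : Supports Q .R) (ιpf : Perfection P →* Q) (hι : ιpf.comp (Perfection.of P) = P.subtype) :
    IsGroupSaturated (MonoidHom.mrange ιpf) :=
  Lemma35.isGroupSaturated_mrange_extension (isPerfect_of_supports_R hQ) hP ιpf hι

/-- **Lemma 3.5 (i) for `treeMonoidVocab` reduces to its realification clause**: if, under the
printed hypotheses (a)–(c), the inclusion extends uniquely and injectively to `P^rlf → Q` for every
realification `ρ : P → R` of `P` (`IsRealificationVia`), then the named fact `Lemma35_i treeMonoidVocab`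
holds — the `P^pf` clauses being `Lemma35_i_pf`. [cite: MochizukiEtTh2009, Lem 3.5 p.75] -/
theorem Lemma35_i_of_rlf
    (hrlf : ∀ (Q : Type w) [CommMonoid Q] (P : Submonoid Q),
      IsPerfFactorial P → IsPerfFactorial Q → IsGroupSaturated P → Supports Q .R →
        ∀ (R : Type w) [CommMonoid R] (ρ : (P : Type w) →* R), IsRealificationVia P R ρ →
          (∃! ιrlf : R →* Q, ιrlf.comp ρ = P.subtype) ∧
          ∀ ιrlf : R →* Q, ιrlf.comp ρ = P.subtype → Function.Injective ιrlf) :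
    Lemma35_i treeMonoidVocab.{w} := by
  intro Q _ P hP hQ hsat hR
  refine ⟨(Lemma35_i_pf Q P hR).1, (Lemma35_i_pf Q P hR).2, ?_⟩
  intro R _ ρ hρ
  exact hrlf Q P hP hQ hsat hR R ρ hρ

/-- **Lemma 3.5 (ii) for `treeMonoidVocab` reduces to its realification clause**: if, under the
printed hypotheses, the image of every extension `P^rlf → Q` is group-saturated, then the named fact
`Lemma35_ii treeMonoidVocab` holds — the `P^pf` clause being `Lemma35_ii_pf`.
[cite: MochizukiEtTh2009, Lem 3.5 p.75] -/
theorem Lemma35_ii_of_rlf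
    (hrlf : ∀ (Q : Type w) [CommMonoid Q] (P : Submonoid Q),
      IsPerfFactorial P → IsPerfFactorial Q → IsGroupSaturated P → Supports Q .R →
        ∀ (R : Type w) [CommMonoid R] (ρ : (P : Type w) →* R), IsRealificationVia P R ρ →
          ∀ ιrlf : R →* Q, ιrlf.comp ρ = P.subtype → IsGroupSaturated (MonoidHom.mrange ιrlf)) :
    Lemma35_ii treeMonoidVocab.{w} := by
  intro Q _ P hP hQ hsat hR
  refine ⟨fun ι hι => Lemma35_ii_pf Q P hsat hR ι hι, ?_⟩
  intro R _ ρ hρ ι hι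
  exact hrlf Q P hP hQ hsat hR R ρ hρ ι hι

end Literature.AnabelianGeometry.EtaleTheta
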